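import Mathlib.MeasureTheory.Integral.IntervalIntegral.AbsolutelyContinuousFun
import Mathlib.MeasureTheory.Function.AbsolutelyContinuous
import Mathlib.Analysis.Calculus.FDeriv.Measurable
import Summits.QuantumFields.YangMills.Theorems.BalabanUVNodesN19TriangleWaveSquareFunction
import Summits.QuantumFields.YangMills.Theorems.BalabanUVNodesN19LacunaryCosineSums

/-!
# N19 (NE7, s3 ALTERNATIVE CURRENCY) — Lipschitz observables have absolutely summable Chebyshev coefficients

Module 97 of the `dag-n19-e` lineage (uniform-moment currency, fixed observables; the POSITIVE side of
CURRENCY-MAP v3 item (w′), one currency up).  Bernstein's absolute-convergence theorem in the form the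
lineage needs, by Bessel only:

* §1 sine orthogonality and BESSEL FOR THE SINES on `[0,π]` (by hand, as module 85 did for cosines):
  `Σ_{m<N} (∫_0^π f sin((m+1)·))² ≤ (π∕2)∫_0^π f² ≤ (π²∕2)M²` for bounded measurable `f`;
* §2 for `G` `K`-Lipschitz on `[−1,1]`, `F = G∘cos` is `K`-Lipschitz on `ℝ`, `|F′| ≤ K`, and ONE
  integration by parts (absolutely continuous `F`, Mathlib `AbsolutelyContinuousOnInterval`) gives
  `(m+1)·∫_0^π F cos((m+1)·) = −∫_0^π F′ sin((m+1)·)`; Cauchy–Schwarz with `Σ 1∕(m+1)² ≤ π²∕6` (module 86)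
  yields ★★ `sum_abs_cosCoeff_le`: `Σ_{m<N} |∫_0^π G(cos θ)cos((m+1)θ)dθ| ≤ π²K∕(2√3)` for every `N`,
  i.e. the Chebyshev coefficients `a_l = (2∕π)∫_0^π G(cos θ)cos(lθ)dθ` satisfy `Σ_{l≥1}|a_l| ≤ πK∕√3`.

Module 98 turns this into the LINEAR price of a Lipschitz observable in the CHEBYSHEV-moment currency.

HONEST FRAMING: [folklore] real analysis (Bessel, integration by parts) over Mathlib and modules 85∕86∕93
BY NAME; no consumer in the DAG today; nothing of Bałaban's is instantiated; NE7 is NOT PRINTED and NOT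
proved here; N19 is NOT discharged; count-neutral.  One finite 𝕋⁴ programme at fixed ε; nothing continuum
∕ OS ∕ mass-gap ∕ Clay.
-/

open Real Finset MeasureTheory

namespace Summit.QuantumFields.YangMills.Theorems.BalabanUVNodesN19LipschitzChebyshevCoefficients

open BalabanUVNodesN19TriangleWaveBessel BalabanUVNodesN19LacunaryCosineSums

/-! ## §1 Bessel for the sines on `[0,π]` [folklore] -/

/-- `∫_0^π sin((m+1)θ)sin((m'+1)θ)dθ = (π∕2)[m = m']`. [folklore] -/
theorem integral_sin_succ_mul_sin_succ (m m' : ℕ) :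
    ∫ θ in (0 : ℝ)..π, Real.sin (((m : ℝ) + 1) * θ) * Real.sin (((m' : ℝ) + 1) * θ) = if m = m' then π / 2 else 0 := by
  have e : ∀ θ : ℝ, Real.sin (((m : ℝ) + 1) * θ) * Real.sin (((m' : ℝ) + 1) * θ) =
      (1 / 2 : ℝ) * Real.cos ((((m : ℤ) - m' : ℤ) : ℝ) * θ) - (1 / 2 : ℝ) * Real.cos ((((m : ℤ) + m' + 2 : ℤ) : ℝ) * θ) := by
    intro θ
    have h := Real.two_mul_sin_mul_sin (((m : ℝ) + 1) * θ) (((m' : ℝ) + 1) * θ)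
    have e1 : ((((m : ℤ) - m' : ℤ) : ℝ)) * θ = ((m : ℝ) + 1) * θ - ((m' : ℝ) + 1) * θ := by push_cast; ring
    have e2 : ((((m : ℤ) + m' + 2 : ℤ) : ℝ)) * θ = ((m : ℝ) + 1) * θ + ((m' : ℝ) + 1) * θ := by push_cast; ring
    rw [e1, e2]; linarith
  have hc : ∀ N : ℤ, Continuous fun θ : ℝ => Real.cos ((N : ℝ) * θ) := fun N =>
    Real.continuous_cos.comp (continuous_const.mul continuous_id)
  simp_rw [e]
  rw [intervalIntegral.integral_sub (((hc _).intervalIntegrable _ _).const_mul _)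
    (((hc _).intervalIntegrable _ _).const_mul _), intervalIntegral.integral_const_mul,
    intervalIntegral.integral_const_mul, integral_cos_int_mul (N := (m : ℤ) + m' + 2) (by omega)]
  split_ifs with h
  · subst h
    have h0 : ∫ θ in (0 : ℝ)..π, Real.cos ((((m : ℤ) - m : ℤ) : ℝ) * θ) = π := by simp
    rw [h0]; ring
  · rw [integral_cos_int_mul (N := (m : ℤ) - m') (by omega)]; simp

/-- **BESSEL FOR THE SINES ON `[0,π]`** (finite form): `Σ_{m<N} (∫_0^π f sin((m+1)·))² ≤ (π∕2)∫_0^π f²`. [folklore] -/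
theorem sum_sq_sinCoeff_le {f : ℝ → ℝ} {M : ℝ} (hf : Measurable f) (hb : ∀ θ, |f θ| ≤ M) (N : ℕ) :
    ∑ m ∈ Finset.range N, (∫ θ in (0 : ℝ)..π, f θ * Real.sin (((m : ℝ) + 1) * θ)) ^ 2 ≤
      π / 2 * ∫ θ in (0 : ℝ)..π, f θ ^ 2 := by
  set c : ℕ → ℝ := fun m => ∫ θ in (0 : ℝ)..π, f θ * Real.sin (((m : ℝ) + 1) * θ) with hc
  set S : ℝ → ℝ := fun θ => ∑ m ∈ Finset.range N, (2 / π * c m) * Real.sin (((m : ℝ) + 1) * θ) with hS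
  have hsin_cont : ∀ m : ℕ, Continuous fun θ : ℝ => Real.sin (((m : ℝ) + 1) * θ) := fun m =>
    Real.continuous_sin.comp (continuous_const.mul continuous_id)
  have hSc : Continuous S := by
    simp only [hS]
    exact continuous_finsetSum _ fun m _ => continuous_const.mul (hsin_cont m)
  have hfi : IntervalIntegrable f volume 0 π := intervalIntegrable_of_bounded hf hb 0 π
  have hf2i : IntervalIntegrable (fun θ => f θ ^ 2) volume 0 π := by
    refine intervalIntegrable_of_bounded (M := M ^ 2) (hf.pow_const 2) (fun θ => ?_) 0 π
    rw [abs_pow]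
    exact pow_le_pow_left₀ (abs_nonneg _) (hb θ) 2
  have hfSi : IntervalIntegrable (fun θ => f θ * S θ) volume 0 π := hfi.mul_continuousOn hSc.continuousOn
  have hSSi : IntervalIntegrable (fun θ => S θ * S θ) volume 0 π := (hSc.mul hSc).intervalIntegrable _ _
  have hsini : ∀ m : ℕ, IntervalIntegrable (fun θ => f θ * Real.sin (((m : ℝ) + 1) * θ)) volume 0 π := fun m =>
    hfi.mul_continuousOn (hsin_cont m).continuousOn
  have ha : ∫ θ in (0 : ℝ)..π, f θ * S θ = 2 / π * ∑ m ∈ Finset.range N, c m ^ 2 := by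
    have e : ∀ θ, f θ * S θ = ∑ m ∈ Finset.range N, (2 / π * c m) * (f θ * Real.sin (((m : ℝ) + 1) * θ)) := by
      intro θ; simp only [hS, Finset.mul_sum]; exact Finset.sum_congr rfl fun m _ => by ring
    simp_rw [e]
    rw [intervalIntegral.integral_finsetSum fun m _ => (hsini m).const_mul _, Finset.mul_sum]
    refine Finset.sum_congr rfl fun m _ => ?_
    rw [intervalIntegral.integral_const_mul]
    simp only [hc]
    ring
  have hb' : ∫ θ in (0 : ℝ)..π, S θ * S θ = 2 / π * ∑ m ∈ Finset.range N, c m ^ 2 := by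
    have e : ∀ θ, S θ * S θ = ∑ m ∈ Finset.range N, ∑ m' ∈ Finset.range N,
        (2 / π * c m) * (2 / π * c m') * (Real.sin (((m : ℝ) + 1) * θ) * Real.sin (((m' : ℝ) + 1) * θ)) := by
      intro θ; simp only [hS, Finset.sum_mul_sum]
      exact Finset.sum_congr rfl fun m _ => Finset.sum_congr rfl fun m' _ => by ring
    simp_rw [e]
    have hterm : ∀ m m' : ℕ, Continuous fun θ : ℝ =>
        (2 / π * c m) * (2 / π * c m') * (Real.sin (((m : ℝ) + 1) * θ) * Real.sin (((m' : ℝ) + 1) * θ)) :=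
      fun m m' => continuous_const.mul ((hsin_cont m).mul (hsin_cont m'))
    rw [intervalIntegral.integral_finsetSum fun m _ =>
      (continuous_finsetSum _ fun m' _ => hterm m m').intervalIntegrable _ _]
    have inner : ∀ m ∈ Finset.range N, ∫ θ in (0 : ℝ)..π, ∑ m' ∈ Finset.range N,
        (2 / π * c m) * (2 / π * c m') * (Real.sin (((m : ℝ) + 1) * θ) * Real.sin (((m' : ℝ) + 1) * θ)) =
          2 / π * c m ^ 2 := by
      intro m hm
      rw [intervalIntegral.integral_finsetSum fun m' _ => (hterm m m').intervalIntegrable _ _]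
      have e2 : ∀ m' ∈ Finset.range N, ∫ θ in (0 : ℝ)..π,
          (2 / π * c m) * (2 / π * c m') * (Real.sin (((m : ℝ) + 1) * θ) * Real.sin (((m' : ℝ) + 1) * θ)) =
            if m = m' then (2 / π * c m) * (2 / π * c m') * (π / 2) else 0 := by
        intro m' _
        rw [intervalIntegral.integral_const_mul, integral_sin_succ_mul_sin_succ]
        split_ifs <;> simp
      rw [Finset.sum_congr rfl e2, Finset.sum_ite_eq]
      rw [if_pos hm]
      field_simp
    rw [Finset.sum_congr rfl inner, Finset.mul_sum]
  have hpos : 0 ≤ ∫ θ in (0 : ℝ)..π, (f θ - S θ) ^ 2 :=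
    intervalIntegral.integral_nonneg Real.pi_pos.le fun θ _ => sq_nonneg _
  have hexp : ∫ θ in (0 : ℝ)..π, (f θ - S θ) ^ 2 =
      (∫ θ in (0 : ℝ)..π, f θ ^ 2) - 2 * (∫ θ in (0 : ℝ)..π, f θ * S θ) + ∫ θ in (0 : ℝ)..π, S θ * S θ := by
    have e : ∀ θ, (f θ - S θ) ^ 2 = (f θ ^ 2 - 2 * (f θ * S θ)) + S θ * S θ := fun θ => by ring
    simp_rw [e]
    rw [intervalIntegral.integral_add (hf2i.sub (hfSi.const_mul 2)) hSSi,
      intervalIntegral.integral_sub hf2i (hfSi.const_mul 2), intervalIntegral.integral_const_mul]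
  rw [hexp, ha, hb'] at hpos
  have hπ := Real.pi_pos
  have key : 2 / π * ∑ m ∈ Finset.range N, c m ^ 2 ≤ ∫ θ in (0 : ℝ)..π, f θ ^ 2 := by linarith
  calc ∑ m ∈ Finset.range N, c m ^ 2 = π / 2 * (2 / π * ∑ m ∈ Finset.range N, c m ^ 2) := by field_simp
    _ ≤ π / 2 * ∫ θ in (0 : ℝ)..π, f θ ^ 2 := mul_le_mul_of_nonneg_left key (by positivity)

/-- Bessel for the sines, bounded form: `Σ_{m<N} (∫_0^π f sin((m+1)·))² ≤ (π²∕2)M²` for `|f| ≤ M`. [folklore] -/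
theorem sum_sq_sinCoeff_le_sq {f : ℝ → ℝ} {M : ℝ} (hf : Measurable f) (hb : ∀ θ, |f θ| ≤ M) (N : ℕ) :
    ∑ m ∈ Finset.range N, (∫ θ in (0 : ℝ)..π, f θ * Real.sin (((m : ℝ) + 1) * θ)) ^ 2 ≤ π ^ 2 / 2 * M ^ 2 := by
  have h1 : ∫ θ in (0 : ℝ)..π, f θ ^ 2 ≤ ∫ θ in (0 : ℝ)..π, M ^ 2 := by
    refine intervalIntegral.integral_mono_on Real.pi_pos.le ?_ (by simp) fun θ _ => ?_
    · refine intervalIntegrable_of_bounded (M := M ^ 2) (hf.pow_const 2) (fun θ => ?_) 0 π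
      rw [abs_pow]; exact pow_le_pow_left₀ (abs_nonneg _) (hb θ) 2
    · calc f θ ^ 2 = |f θ| ^ 2 := (sq_abs _).symm
        _ ≤ M ^ 2 := pow_le_pow_left₀ (abs_nonneg _) (hb θ) 2
  rw [intervalIntegral.integral_const, smul_eq_mul, sub_zero] at h1
  have := sum_sq_sinCoeff_le hf hb N
  nlinarith [Real.pi_pos]

/-! ## §2 Lipschitz `G`: integration by parts and the `ℓ¹` bound on the Chebyshev coefficients [folklore] -/

/-- A Lipschitz constant on `[−1,1]` is nonnegative. [bookkeeping] -/
theorem lipConst_nonneg {G : ℝ → ℝ} {K : ℝ}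
    (hK : ∀ x y : ℝ, x ∈ Set.Icc (-1 : ℝ) 1 → y ∈ Set.Icc (-1 : ℝ) 1 → |G x - G y| ≤ K * |x - y|) : 0 ≤ K := by
  have h := hK 1 (-1) ⟨by norm_num, le_rfl⟩ ⟨le_rfl, by norm_num⟩
  have : (0 : ℝ) ≤ K * |(1 : ℝ) - -1| := (abs_nonneg _).trans h
  norm_num at this
  linarith

/-- `G∘cos` is `K`-Lipschitz on `ℝ` when `G` is `K`-Lipschitz on `[−1,1]`. [folklore] -/
theorem lipschitzWith_compCos {G : ℝ → ℝ} {K : ℝ}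
    (hK : ∀ x y : ℝ, x ∈ Set.Icc (-1 : ℝ) 1 → y ∈ Set.Icc (-1 : ℝ) 1 → |G x - G y| ≤ K * |x - y|) :
    LipschitzWith (Real.toNNReal K) (fun θ : ℝ => G (Real.cos θ)) := by
  refine LipschitzWith.of_dist_le' fun θ θ' => ?_
  have hc : ∀ t : ℝ, Real.cos t ∈ Set.Icc (-1 : ℝ) 1 := fun t => ⟨Real.neg_one_le_cos t, Real.cos_le_one t⟩
  rw [Real.dist_eq, Real.dist_eq]
  exact (hK _ _ (hc θ) (hc θ')).trans
    (mul_le_mul_of_nonneg_left (Real.abs_cos_sub_cos_le θ θ') (lipConst_nonneg hK))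

/-- `|(G∘cos)′| ≤ K` everywhere (`deriv = 0` where not differentiable). [folklore] -/
theorem abs_deriv_compCos_le {G : ℝ → ℝ} {K : ℝ}
    (hK : ∀ x y : ℝ, x ∈ Set.Icc (-1 : ℝ) 1 → y ∈ Set.Icc (-1 : ℝ) 1 → |G x - G y| ≤ K * |x - y|) (θ : ℝ) :
    |deriv (fun θ : ℝ => G (Real.cos θ)) θ| ≤ K := by
  have h := norm_deriv_le_of_lipschitz (x₀ := θ) (lipschitzWith_compCos hK)
  rwa [Real.norm_eq_abs, Real.coe_toNNReal _ (lipConst_nonneg hK)] at h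

/-- ★ ONE INTEGRATION BY PARTS: `(m+1)·∫_0^π G(cos θ)cos((m+1)θ)dθ = −∫_0^π (G∘cos)′(θ) sin((m+1)θ)dθ`
for `G` Lipschitz on `[−1,1]` (`G∘cos` is absolutely continuous; the boundary terms vanish). [folklore] -/
theorem succ_mul_integral_compCos_mul_cos {G : ℝ → ℝ} {K : ℝ}
    (hK : ∀ x y : ℝ, x ∈ Set.Icc (-1 : ℝ) 1 → y ∈ Set.Icc (-1 : ℝ) 1 → |G x - G y| ≤ K * |x - y|) (m : ℕ) :
    ((m : ℝ) + 1) * ∫ θ in (0 : ℝ)..π, G (Real.cos θ) * Real.cos (((m : ℝ) + 1) * θ) =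
      -∫ θ in (0 : ℝ)..π, deriv (fun θ : ℝ => G (Real.cos θ)) θ * Real.sin (((m : ℝ) + 1) * θ) := by
  set F : ℝ → ℝ := fun θ => G (Real.cos θ) with hF
  have hm : ((m : ℝ) + 1) ≠ 0 := by positivity
  have hFac : AbsolutelyContinuousOnInterval F 0 π :=
    ((lipschitzWith_compCos hK).lipschitzOnWith (s := Set.uIcc 0 π)).absolutelyContinuousOnInterval
  -- `g(θ) = sin((m+1)θ)∕(m+1)`, `g′ = cos((m+1)θ)`
  have hgd : ∀ θ : ℝ, HasDerivAt (fun θ : ℝ => Real.sin (((m : ℝ) + 1) * θ) / ((m : ℝ) + 1))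
      (Real.cos (((m : ℝ) + 1) * θ)) θ := fun θ => by
    have h1 : HasDerivAt (fun θ : ℝ => ((m : ℝ) + 1) * θ) ((m : ℝ) + 1) θ := by
      simpa using (hasDerivAt_id θ).const_mul ((m : ℝ) + 1)
    exact (h1.sin.div_const ((m : ℝ) + 1)).congr_deriv (by field_simp)
  have hgac : AbsolutelyContinuousOnInterval (fun θ : ℝ => Real.sin (((m : ℝ) + 1) * θ) / ((m : ℝ) + 1)) 0 π := by
    have : ContDiff ℝ 1 (fun θ : ℝ => Real.sin (((m : ℝ) + 1) * θ) / ((m : ℝ) + 1)) := by fun_prop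
    exact (this.contDiffOn (s := Set.uIcc 0 π)).absolutelyContinuousOnInterval
  have hibp := hFac.integral_mul_deriv_eq_deriv_mul hgac
  have hdg : ∀ θ, deriv (fun θ : ℝ => Real.sin (((m : ℝ) + 1) * θ) / ((m : ℝ) + 1)) θ = Real.cos (((m : ℝ) + 1) * θ) :=
    fun θ => (hgd θ).deriv
  simp_rw [hdg] at hibp
  have hb1 : Real.sin (((m : ℝ) + 1) * π) = 0 := by exact_mod_cast Real.sin_nat_mul_pi (m + 1)
  have hb0 : Real.sin (((m : ℝ) + 1) * π) / ((m : ℝ) + 1) = 0 := by rw [hb1, zero_div]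
  have hb0' : Real.sin (((m : ℝ) + 1) * 0) / ((m : ℝ) + 1) = 0 := by simp
  rw [hb0, hb0', mul_zero, mul_zero, sub_zero, zero_sub] at hibp
  rw [hibp, mul_neg, ← intervalIntegral.integral_const_mul]
  congr 1
  refine intervalIntegral.integral_congr fun θ _ => ?_
  simp only [hF]
  field_simp

/-- ★★ **LIPSCHITZ OBSERVABLES HAVE ABSOLUTELY SUMMABLE CHEBYSHEV COEFFICIENTS**: for `G` `K`-Lipschitz on
`[−1,1]` and every `N`, `Σ_{m<N} |∫_0^π G(cos θ)cos((m+1)θ)dθ| ≤ π²K∕(2√3)`; equivalently the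
coefficients `a_l = (2∕π)∫_0^π G(cos θ)cos(lθ)dθ` of `G = a_0∕2 + Σ_{l≥1} a_l T_l` have
`Σ_{l≥1}|a_l| ≤ πK∕√3`.  (IBP + Bessel for the sines + `Σ1∕l² = π²∕6`.) [folklore] -/
theorem sum_abs_cosCoeff_le {G : ℝ → ℝ} {K : ℝ}
    (hK : ∀ x y : ℝ, x ∈ Set.Icc (-1 : ℝ) 1 → y ∈ Set.Icc (-1 : ℝ) 1 → |G x - G y| ≤ K * |x - y|) (N : ℕ) :
    ∑ m ∈ Finset.range N, |∫ θ in (0 : ℝ)..π, G (Real.cos θ) * Real.cos (((m : ℝ) + 1) * θ)| ≤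
      π ^ 2 * K / (2 * Real.sqrt 3) := by
  set F' : ℝ → ℝ := deriv (fun θ : ℝ => G (Real.cos θ)) with hF'
  have hF'm : Measurable F' := measurable_deriv _
  have hF'b : ∀ θ, |F' θ| ≤ K := abs_deriv_compCos_le hK
  set s : ℕ → ℝ := fun m => ∫ θ in (0 : ℝ)..π, F' θ * Real.sin (((m : ℝ) + 1) * θ) with hs
  have hK0 := lipConst_nonneg hK
  -- each term: `|∫ F cos((m+1)·)| = |s_m| ∕ (m+1)`
  have hterm : ∀ m : ℕ, |∫ θ in (0 : ℝ)..π, G (Real.cos θ) * Real.cos (((m : ℝ) + 1) * θ)| =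
      1 / ((m : ℝ) + 1) * |s m| := by
    intro m
    have h := succ_mul_integral_compCos_mul_cos hK m
    have hm : (0 : ℝ) < (m : ℝ) + 1 := by positivity
    have : ∫ θ in (0 : ℝ)..π, G (Real.cos θ) * Real.cos (((m : ℝ) + 1) * θ) = -(1 / ((m : ℝ) + 1)) * s m := by
      simp only [hs]; field_simp; linarith
    rw [this, abs_mul, abs_neg, abs_of_pos (by positivity : (0 : ℝ) < 1 / ((m : ℝ) + 1))]
  simp_rw [hterm]
  -- Cauchy–Schwarz
  have hCS := Finset.sum_mul_sq_le_sq_mul_sq (Finset.range N) (fun m => 1 / ((m : ℝ) + 1)) (fun m => |s m|)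
  have h1 : ∑ m ∈ Finset.range N, (1 / ((m : ℝ) + 1)) ^ 2 ≤ π ^ 2 / 6 := by
    have := BalabanUVNodesN19TriangleWaveSquareFunction.sum_one_div_succ_sq_le N
    refine le_trans (le_of_eq (Finset.sum_congr rfl fun m _ => ?_)) this
    rw [div_pow, one_pow]
  have h2 : ∑ m ∈ Finset.range N, |s m| ^ 2 ≤ π ^ 2 / 2 * K ^ 2 := by
    have := sum_sq_sinCoeff_le_sq hF'm hF'b N
    refine le_trans (le_of_eq (Finset.sum_congr rfl fun m _ => ?_)) this
    rw [sq_abs]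
  have hsq : (∑ m ∈ Finset.range N, 1 / ((m : ℝ) + 1) * |s m|) ^ 2 ≤ (π ^ 2 * K / (2 * Real.sqrt 3)) ^ 2 := by
    have h3 : (0 : ℝ) < Real.sqrt 3 := Real.sqrt_pos.2 (by norm_num)
    have h33 : Real.sqrt 3 ^ 2 = 3 := Real.sq_sqrt (by norm_num)
    calc (∑ m ∈ Finset.range N, 1 / ((m : ℝ) + 1) * |s m|) ^ 2
        ≤ (∑ m ∈ Finset.range N, (1 / ((m : ℝ) + 1)) ^ 2) * ∑ m ∈ Finset.range N, |s m| ^ 2 := hCS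
      _ ≤ (π ^ 2 / 6) * (π ^ 2 / 2 * K ^ 2) :=
          mul_le_mul h1 h2 (Finset.sum_nonneg fun m _ => sq_nonneg _) (by positivity)
      _ = (π ^ 2 * K / (2 * Real.sqrt 3)) ^ 2 := by rw [div_pow, mul_pow, mul_pow, h33]; ring
  exact (abs_le_of_sq_le_sq' hsq (by positivity)).2

/-- Summable form: the coefficients `∫_0^π G(cos θ)cos((m+1)θ)dθ` are absolutely summable with
`Σ' ≤ π²K∕(2√3)`. [folklore] -/
theorem summable_abs_cosCoeff {G : ℝ → ℝ} {K : ℝ}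
    (hK : ∀ x y : ℝ, x ∈ Set.Icc (-1 : ℝ) 1 → y ∈ Set.Icc (-1 : ℝ) 1 → |G x - G y| ≤ K * |x - y|) :
    Summable (fun m : ℕ => |∫ θ in (0 : ℝ)..π, G (Real.cos θ) * Real.cos (((m : ℝ) + 1) * θ)|) ∧
    ∑' m : ℕ, |∫ θ in (0 : ℝ)..π, G (Real.cos θ) * Real.cos (((m : ℝ) + 1) * θ)| ≤ π ^ 2 * K / (2 * Real.sqrt 3) := by
  have hs : Summable (fun m : ℕ => |∫ θ in (0 : ℝ)..π, G (Real.cos θ) * Real.cos (((m : ℝ) + 1) * θ)|) :=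
    summable_of_sum_range_le (fun m => abs_nonneg _) (sum_abs_cosCoeff_le hK)
  exact ⟨hs, tsum_le_of_sum_range_le (fun m => abs_nonneg _) (sum_abs_cosCoeff_le hK)⟩

end Summit.QuantumFields.YangMills.Theorems.BalabanUVNodesN19LipschitzChebyshevCoefficients
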